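import Summits.Parity.GeneralizedHardyLittlewood.Theorems.PrimeLevelFamEdgeMomentsBeyondDiagonalDiagDecorTauEngines
import HarnessLib

/-!
# Route `PrimeLevelFamEdge`, crux K_A `MomentsBeyondDiagonal` (stmt-Parity-20007), line «petersson_layers» v4, stub `stub_diag`:
# **the DECORATED profile coordinates:
# `Σ_c P_c·S⁽ᶜ⁾_{τ₁₁}(M/n;n)/logᶜM = E_n·P(u_n) + O_P(D(n)(1+κ(n))/log M)`,
# `Σ_c P_c·S⁽ᶜ⁾_{τ₁₀}(M/n;n)/logᶜM = −E_n·P′(u_n)/log M + O_P(D(n)(1+κ(n))/log²M)`,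
# `Σ_c P_c·S⁽ᶜ⁾_{τ₂₀}(M/n;n)/logᶜM = O_P(D(n)(1+κ(n))/log M)`**, `u_n = log(M/n)/log M`

Census R3(ii), ANALYTIC HALF: the profile layer (the analogue of `…DiagProfileCoord`, p814057) over the decorated `k`-sum
engines of `…DiagDecorTauEngines`. In the decorated Selberg coordinates of `…DiagOrderSelberg` the mollifier weight at
`cgk` is `W(cg)·W(k)[(k,cg)=1]·P(log(M/(cgk))/log M)` and `P(log(M/(nk))/log M) = Σ_c P_c logᶜ((M/n)/k)/logᶜM`, so every
`k`-sum of the order-`(i,j)` target is a PROFILE COORDINATE `Σ_c P_c S⁽ᶜ⁾_w(M/n;n)/logᶜM` of some decorated coprime sum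
`S⁽ᶜ⁾_w(y;n) = Σ_{k≤y} w_n(k)logᶜ(y/k)`:

* `abs_profileLayer_sub_le` — **generic profile layer**: if `|S⁽ᶜ⁾_w(y;n) − m_c·E_n·log^{c−s}y| ≤ K_c·D(n)(1+κ(n))(1+log y)^{c−s−1}`
  for every `c ≥ 2` (`s ≤ 1`), then for `P₀ = P₁ = 0`, `M ≥ 3`, `1 ≤ n ≤ M`:
  `|Σ_c P_c S⁽ᶜ⁾_w(M/n;n)/logᶜM − E_n·Σ_c P_c m_c log^{c−s}(M/n)/logᶜM| ≤ C_P·D(n)(1+κ(n))/log^{s+1}M`;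
* `abs_decorProfile_tau11_sub_le` — `w = W[(·,n)=1]τ_{1,1}`, `m_c = 1`, `s = 0`: main term **`E_n·P(u_n)`**, error `/log M`;
* `abs_decorProfile_tau10_add_le` — `w = W[(·,n)=1]τ_{1,0}`, `m_c = −c`, `s = 1`: main term **`−E_n·P′(u_n)/log M`**, error `/log²M`;
* `abs_decorProfile_tau20_le` — `w = W[(·,n)=1]τ_{2,0}`, `m_c = 0`: **no main term at this precision**, error `/log M`.

(Undecorated: `E_n·P″(u_n)/log²M`, `…DiagProfileCoord`.) These are the `n`-pointwise inputs of the `(c,g) ↦ n` collapse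
(weights `Σ_{cg=n}μ(g)c = φ(n)`, `Σ_{cg=n}μ(g)c·log g = −φ(n)κ(n)`, …) for the per-order targets `(1,1)`, `(2,0)`, `(0,2)` of
`subDiag_of_selbergOrderAsymptotics`. Def-free; theorems only. Helper `--supports stmt-Parity-20007`; closes nothing; K_A,
K_B and the Parity summit are NOT proved; nothing about Landau–Siegel zeros.

## References
* E. Kowalski, P. Michel, J. VanderKam, J. reine angew. Math. 526 (2000), (23)–(28) pp. 13–15 and Prop. 5.1 p. 18
  (the residue evaluation of the diagonal main term; here the log-decorations of a general `Q` in real variables).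
  [cite: KowalskiMichelVanderKam2000, (23)–(28) — derivation (decorated profile coordinates)]
-/

noncomputable section

open scoped Real
open Finset ArithmeticFunction Polynomial

namespace Summit.Parity.GeneralizedHardyLittlewood.Theorems.MomentsBeyondDiagonal.DiagKernel

open Literature.NumberTheory.LFunctions Literature.NumberTheory.LFunctions.KMV2000
open MollifierMainTerm (W)
open SelbergCoord (kappa)
open Literature.NumberTheory.Sieve (one_le_log_of_three_le)
open Summit.Parity.GeneralizedHardyLittlewood.Theorems.BeyondDiagonalBeatsQuarter.KernelFormXSq
  (mainConst divWeight divWeight_nonneg mainConst_nonneg)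

/-! ### The generic profile layer -/

/-- **Generic profile layer.** Let `S n y c` be any family of `k`-sums with
`|S n y c − m_c·E_n·log^{c−s}y| ≤ K_c·D(n)(1+κ(n))(1+log y)^{c−s−1}` for every `c ≥ 2`, `n ≥ 1`, `y ≥ 1` (`s ≤ 1`). Then for
every real polynomial `P` with `P₀ = P₁ = 0` there is `C_P` with, for `M ≥ 3`, `1 ≤ n ≤ M`:
`|Σ_c P_c·S n (M/n) c/logᶜM − E_n·Σ_c P_c·m_c·log^{c−s}(M/n)/logᶜM| ≤ C_P·D(n)(1+κ(n))/log^{s+1}M`.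
[cite: KowalskiMichelVanderKam2000, Prop. 5.1 — derivation (profile layer, real variables)] -/
theorem abs_profileLayer_sub_le (S : ℕ → ℝ → ℕ → ℝ) (m : ℕ → ℝ) {s : ℕ} (hs : s ≤ 1)
    (hS : ∀ c : ℕ, 2 ≤ c → ∃ K : ℝ, 0 < K ∧ ∀ n : ℕ, n ≠ 0 → ∀ y : ℝ, 1 ≤ y →
      |S n y c - m c * mainConst n * Real.log y ^ (c - s)| ≤
        K * divWeight n * (1 + kappa n) * (1 + Real.log y) ^ (c - s - 1))
    (P : ℝ[X]) (hP0 : P.coeff 0 = 0) (hP1 : P.coeff 1 = 0) :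
    ∃ C : ℝ, 0 < C ∧ ∀ M : ℝ, 3 ≤ M → ∀ n : ℕ, n ≠ 0 → (n : ℝ) ≤ M →
      |∑ c ∈ Finset.range (P.natDegree + 1), P.coeff c * (S n (M / n) c / Real.log M ^ c) -
          mainConst n * ∑ c ∈ Finset.range (P.natDegree + 1), P.coeff c *
            (m c * Real.log (M / n) ^ (c - s) / Real.log M ^ c)| ≤
        C * divWeight n * (1 + kappa n) / Real.log M ^ (s + 1) := by
  -- one constant per order (orders `< 2` get a dummy constant)
  have hK : ∀ c : ℕ, ∃ K : ℝ, 0 < K ∧ (2 ≤ c → ∀ n : ℕ, n ≠ 0 → ∀ y : ℝ, 1 ≤ y →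
      |S n y c - m c * mainConst n * Real.log y ^ (c - s)| ≤
        K * divWeight n * (1 + kappa n) * (1 + Real.log y) ^ (c - s - 1)) := by
    intro c
    by_cases hc : 2 ≤ c
    · obtain ⟨K, hK, h⟩ := hS c hc
      exact ⟨K, hK, fun _ ↦ h⟩
    · exact ⟨1, one_pos, fun h ↦ absurd h hc⟩
  choose K hK0 hK using hK
  have hKsum : 0 ≤ ∑ c ∈ Finset.range (P.natDegree + 1), |P.coeff c| * K c * 2 ^ (c - s - 1) :=
    Finset.sum_nonneg fun c _ ↦ by have := hK0 c; positivity
  refine ⟨∑ c ∈ Finset.range (P.natDegree + 1), |P.coeff c| * K c * 2 ^ (c - s - 1) + 1, by linarith,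
    fun M hM n hn hnM ↦ ?_⟩
  set ℓ := Real.log M with hℓ
  have hℓ1 : 1 ≤ ℓ := one_le_log_of_three_le hM
  have hℓ0 : 0 < ℓ := by linarith
  obtain ⟨hY0, hYℓ⟩ := log_div_nonneg_and_le hM hn hnM
  have hn1 : (1 : ℝ) ≤ n := by exact_mod_cast Nat.one_le_iff_ne_zero.2 hn
  have hy1 : 1 ≤ M / n := (one_le_div (by linarith)).2 hnM
  have hD := divWeight_nonneg n
  have hκ : 0 ≤ kappa n := by
    unfold kappa
    exact Finset.sum_nonneg fun p hp ↦ by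
      have hp2 : (2 : ℝ) ≤ p := by exact_mod_cast (Nat.prime_of_mem_primeFactors hp).two_le
      exact div_nonneg (Real.log_nonneg (by linarith)) (by linarith)
  set Y := Real.log (M / n) with hY
  -- per-order differences
  set d : ℕ → ℝ := fun c ↦ S n (M / n) c / ℓ ^ c - m c * mainConst n * Y ^ (c - s) / ℓ ^ c with hd
  have hdiff : ∑ c ∈ Finset.range (P.natDegree + 1), P.coeff c * (S n (M / n) c / ℓ ^ c) -
      mainConst n * ∑ c ∈ Finset.range (P.natDegree + 1), P.coeff c * (m c * Y ^ (c - s) / ℓ ^ c) =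
      ∑ c ∈ Finset.range (P.natDegree + 1), P.coeff c * d c := by
    rw [Finset.mul_sum, ← Finset.sum_sub_distrib]
    refine Finset.sum_congr rfl fun c _ ↦ ?_
    simp only [hd]
    ring
  set Z : ℝ := divWeight n * (1 + kappa n) / ℓ ^ (s + 1) with hZ
  have hZ0 : 0 ≤ Z := by positivity
  have hterm : ∀ c ∈ Finset.range (P.natDegree + 1), |P.coeff c * d c| ≤ |P.coeff c| * K c * 2 ^ (c - s - 1) * Z := by
    intro c _
    rw [abs_mul]
    by_cases hc : 2 ≤ c
    · have h := hK c hc n hn (M / n) hy1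
      rw [← hY] at h
      have hpow : ℓ ^ c = ℓ ^ (c - s - 1) * ℓ ^ (s + 1) := by
        rw [← pow_add]; congr 1; omega
      have hdc : |d c| ≤ K c * 2 ^ (c - s - 1) * Z := by
        have hd' : d c = (S n (M / n) c - m c * mainConst n * Y ^ (c - s)) / ℓ ^ c := by
          simp only [hd]; ring
        rw [hd', abs_div, abs_of_pos (pow_pos hℓ0 c), div_le_iff₀ (pow_pos hℓ0 c)]
        calc |S n (M / n) c - m c * mainConst n * Y ^ (c - s)|
            ≤ K c * divWeight n * (1 + kappa n) * (1 + Y) ^ (c - s - 1) := h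
          _ ≤ K c * divWeight n * (1 + kappa n) * (2 * ℓ) ^ (c - s - 1) := by
              refine mul_le_mul_of_nonneg_left (pow_le_pow_left₀ (by linarith) (by linarith) _) ?_
              have := hK0 c; positivity
          _ = K c * 2 ^ (c - s - 1) * Z * ℓ ^ c := by
              rw [hZ, mul_pow, hpow]
              field_simp
      calc |P.coeff c| * |d c| ≤ |P.coeff c| * (K c * 2 ^ (c - s - 1) * Z) :=
            mul_le_mul_of_nonneg_left hdc (abs_nonneg _)
        _ = |P.coeff c| * K c * 2 ^ (c - s - 1) * Z := by ring
    · have hc01 : c = 0 ∨ c = 1 := by omega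
      have hPc : P.coeff c = 0 := by rcases hc01 with rfl | rfl <;> assumption
      rw [hPc, abs_zero, zero_mul, zero_mul, zero_mul, zero_mul]
  rw [hdiff]
  calc |∑ c ∈ Finset.range (P.natDegree + 1), P.coeff c * d c|
      ≤ ∑ c ∈ Finset.range (P.natDegree + 1), |P.coeff c * d c| := Finset.abs_sum_le_sum_abs _ _
    _ ≤ ∑ c ∈ Finset.range (P.natDegree + 1), |P.coeff c| * K c * 2 ^ (c - s - 1) * Z := Finset.sum_le_sum hterm
    _ = (∑ c ∈ Finset.range (P.natDegree + 1), |P.coeff c| * K c * 2 ^ (c - s - 1)) * Z := by rw [Finset.sum_mul]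
    _ ≤ (∑ c ∈ Finset.range (P.natDegree + 1), |P.coeff c| * K c * 2 ^ (c - s - 1) + 1) * Z := by
        gcongr; linarith
    _ = _ := by rw [hZ]; ring

/-! ### The three decorated profile coordinates -/

/-- **The `τ_{1,1}`-decorated profile coordinate: `E_n·P(u_n) + O_P(D(n)(1+κ(n))/log M)`** (`P₀ = P₁ = 0`, `M ≥ 3`,
`1 ≤ n ≤ M`, `u_n = log(M/n)/log M`). [cite: KowalskiMichelVanderKam2000, (23)–(28) and Prop. 5.1 — derivation] -/
theorem abs_decorProfile_tau11_sub_le (P : ℝ[X]) (hP0 : P.coeff 0 = 0) (hP1 : P.coeff 1 = 0) :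
    ∃ C : ℝ, 0 < C ∧ ∀ M : ℝ, 3 ≤ M → ∀ n : ℕ, n ≠ 0 → (n : ℝ) ≤ M →
      |∑ c ∈ Finset.range (P.natDegree + 1), P.coeff c *
            ((∑ k ∈ Icc 1 ⌊M / n⌋₊, (if k.Coprime n then W k else 0) *
              (∑ d ∈ k.divisors, Real.log d * Real.log ((k / d : ℕ) : ℝ)) * Real.log (M / n / k) ^ c) /
              Real.log M ^ c) -
          mainConst n * P.eval (Real.log (M / n) / Real.log M)| ≤
        C * divWeight n * (1 + kappa n) / Real.log M := by
  obtain ⟨C, hC, h⟩ := abs_profileLayer_sub_le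
    (fun n y c ↦ ∑ k ∈ Icc 1 ⌊y⌋₊, (if k.Coprime n then W k else 0) *
      (∑ d ∈ k.divisors, Real.log d * Real.log ((k / d : ℕ) : ℝ)) * Real.log (y / k) ^ c)
    (fun _ ↦ 1) (zero_le_one : 0 ≤ 1) (fun c hc ↦ by
      obtain ⟨K, hK, hK'⟩ := abs_copW_tau11_sum_sub_le hc
      refine ⟨K, hK, fun n hn y hy ↦ ?_⟩
      simpa using hK' n hn y hy) P hP0 hP1
  refine ⟨C, hC, fun M hM n hn hnM ↦ ?_⟩
  have h' := h M hM n hn hnM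
  have hmain : mainConst n * ∑ c ∈ Finset.range (P.natDegree + 1), P.coeff c *
      (1 * Real.log (M / n) ^ (c - 0) / Real.log M ^ c) =
      mainConst n * P.eval (Real.log (M / n) / Real.log M) := by
    rw [Polynomial.eval_eq_sum_range]
    congr 1
    refine Finset.sum_congr rfl fun c _ ↦ ?_
    rw [Nat.sub_zero, one_mul, div_pow]
  rw [hmain, zero_add, pow_one] at h'
  exact h'

/-- **The `τ_{1,0}`-decorated profile coordinate: `−E_n·P′(u_n)/log M + O_P(D(n)(1+κ(n))/log²M)`** (`P₀ = P₁ = 0`,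
`M ≥ 3`, `1 ≤ n ≤ M`). [cite: KowalskiMichelVanderKam2000, (23)–(28) and Prop. 5.1 — derivation] -/
theorem abs_decorProfile_tau10_add_le (P : ℝ[X]) (hP0 : P.coeff 0 = 0) (hP1 : P.coeff 1 = 0) :
    ∃ C : ℝ, 0 < C ∧ ∀ M : ℝ, 3 ≤ M → ∀ n : ℕ, n ≠ 0 → (n : ℝ) ≤ M →
      |∑ c ∈ Finset.range (P.natDegree + 1), P.coeff c *
            ((∑ k ∈ Icc 1 ⌊M / n⌋₊, (if k.Coprime n then W k else 0) *
              (∑ d ∈ k.divisors, Real.log d) * Real.log (M / n / k) ^ c) / Real.log M ^ c) +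
          mainConst n * (derivative P).eval (Real.log (M / n) / Real.log M) / Real.log M| ≤
        C * divWeight n * (1 + kappa n) / Real.log M ^ 2 := by
  obtain ⟨C, hC, h⟩ := abs_profileLayer_sub_le
    (fun n y c ↦ ∑ k ∈ Icc 1 ⌊y⌋₊, (if k.Coprime n then W k else 0) *
      (∑ d ∈ k.divisors, Real.log d) * Real.log (y / k) ^ c)
    (fun c ↦ -(c : ℝ)) (le_refl 1) (fun c hc ↦ by
      obtain ⟨K, hK, hK'⟩ := abs_copW_tau10_sum_add_le hc
      refine ⟨K, hK, fun n hn y hy ↦ ?_⟩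
      have hκ : 0 ≤ kappa n := by
        unfold kappa
        exact Finset.sum_nonneg fun p hp ↦ by
          have hp2 : (2 : ℝ) ≤ p := by exact_mod_cast (Nat.prime_of_mem_primeFactors hp).two_le
          exact div_nonneg (Real.log_nonneg (by linarith)) (by linarith)
      have hD := divWeight_nonneg n
      have hly : 0 ≤ Real.log y := Real.log_nonneg hy
      have e : c - 1 - 1 = c - 2 := by omega
      rw [e]
      calc _ = |∑ k ∈ Icc 1 ⌊y⌋₊, (if k.Coprime n then W k else 0) * (∑ d ∈ k.divisors, Real.log d) *
              Real.log (y / k) ^ c + (c : ℝ) * mainConst n * Real.log y ^ (c - 1)| := by ring_nf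
        _ ≤ K * divWeight n * (1 + Real.log y) ^ (c - 2) := hK' n hn y hy
        _ = K * divWeight n * 1 * (1 + Real.log y) ^ (c - 2) := by ring
        _ ≤ K * divWeight n * (1 + kappa n) * (1 + Real.log y) ^ (c - 2) := by
            gcongr; linarith) P hP0 hP1
  refine ⟨C, hC, fun M hM n hn hnM ↦ ?_⟩
  have hℓ1 : 1 ≤ Real.log M := one_le_log_of_three_le hM
  have hℓ0 : Real.log M ≠ 0 := by linarith
  have h' := h M hM n hn hnM
  set ℓ := Real.log M with hℓ
  set Y := Real.log (M / n) with hY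
  have hderiv : (derivative P).eval (Y / ℓ) =
      ∑ c ∈ Finset.range (P.natDegree + 1), P.coeff c * (c : ℝ) * (Y / ℓ) ^ (c - 1) := by
    rw [Polynomial.derivative_eval]
    exact Polynomial.sum_over_range _ (fun j ↦ by simp)
  have hterm : ∀ c ∈ Finset.range (P.natDegree + 1),
      mainConst n * (P.coeff c * (-(c : ℝ) * Y ^ (c - 1) / ℓ ^ c)) =
        -(mainConst n * (P.coeff c * (c : ℝ) * (Y / ℓ) ^ (c - 1)) / ℓ) := by
    intro c _
    rcases Nat.eq_zero_or_pos c with rfl | hcpos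
    · rw [hP0]; simp
    · have hℓc : ℓ ^ c = ℓ ^ (c - 1) * ℓ := by
        rw [← pow_succ, Nat.sub_add_cancel hcpos]
      rw [div_pow, hℓc]
      field_simp
  have hmain : mainConst n * ∑ c ∈ Finset.range (P.natDegree + 1), P.coeff c *
      (-(c : ℝ) * Y ^ (c - 1) / ℓ ^ c) = -(mainConst n * (derivative P).eval (Y / ℓ) / ℓ) := by
    rw [Finset.mul_sum, Finset.sum_congr rfl hterm, hderiv, Finset.mul_sum, Finset.sum_div,
      ← Finset.sum_neg_distrib]
  rw [hmain, sub_neg_eq_add] at h'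
  exact h'

/-- **The `τ_{2,0}`-decorated profile coordinate is `O_P(D(n)(1+κ(n))/log M)`** (no main term at this precision: the
naive `E_n·(…)·logᶜ` terms cancel; `P₀ = P₁ = 0`, `M ≥ 3`, `1 ≤ n ≤ M`).
[cite: KowalskiMichelVanderKam2000, (23)–(28) and Prop. 5.1 — derivation] -/
theorem abs_decorProfile_tau20_le (P : ℝ[X]) (hP0 : P.coeff 0 = 0) (hP1 : P.coeff 1 = 0) :
    ∃ C : ℝ, 0 < C ∧ ∀ M : ℝ, 3 ≤ M → ∀ n : ℕ, n ≠ 0 → (n : ℝ) ≤ M →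
      |∑ c ∈ Finset.range (P.natDegree + 1), P.coeff c *
            ((∑ k ∈ Icc 1 ⌊M / n⌋₊, (if k.Coprime n then W k else 0) *
              (∑ d ∈ k.divisors, Real.log d ^ 2) * Real.log (M / n / k) ^ c) / Real.log M ^ c)| ≤
        C * divWeight n * (1 + kappa n) / Real.log M := by
  obtain ⟨C, hC, h⟩ := abs_profileLayer_sub_le
    (fun n y c ↦ ∑ k ∈ Icc 1 ⌊y⌋₊, (if k.Coprime n then W k else 0) *
      (∑ d ∈ k.divisors, Real.log d ^ 2) * Real.log (y / k) ^ c)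
    (fun _ ↦ 0) (zero_le_one : 0 ≤ 1) (fun c hc ↦ by
      obtain ⟨K, hK, hK'⟩ := abs_copW_tau20_sum_le hc
      refine ⟨K, hK, fun n hn y hy ↦ ?_⟩
      simpa using hK' n hn y hy) P hP0 hP1
  refine ⟨C, hC, fun M hM n hn hnM ↦ ?_⟩
  have h' := h M hM n hn hnM
  simp only [zero_mul, zero_div, mul_zero, Finset.sum_const_zero, sub_zero, zero_add, pow_one] at h'
  exact h'

end Summit.Parity.GeneralizedHardyLittlewood.Theorems.MomentsBeyondDiagonal.DiagKernel

end
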